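import Summits.AtomisticToContinuum.FouriersLaw.Theorems.BondHeatUncertaintySubdiffusiveBondHeatJunctionRatioBracketExtension
import Summits.AtomisticToContinuum.FouriersLaw.Theorems.BondHeatUncertaintySubdiffusiveBondHeatJunctionRatioBracketParity

/-!
# [BI] — the first-bond bracket identity `FirstBondBracket` («FirstBondBracketProof», 24e)

Last file of the `[BI] ⟸ [EXT] ∧ [LINK]` chain for the residual
`Summit.AtomisticToContinuum.FouriersLaw.Theses.BondHeatUncertainty.BoundedResponse`
(item `stmt-AtomisticToContinuum-11071`), door
`boundedResponse_of_bracket_of_peeled_of_escapeInfZero_of_subOhmicBootstrap′`.  It proves the leaf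
[BI] = `FirstBondBracket` (19b): for the pinned anharmonic chain (`ω₂, lam, β, γ, T > 0`, `N ≥ 3`),
a response density `h`, tap scores `g₀, g₁` at the two bath sites and the moment coefficients
`τ = τ_1`, `τ' = τ_{N−2}`,

  `τ − 1/2 = T ∫ Ψ_T(0,1) g₀ dμ_T`,   `τ' + 1/2 = T ∫ Ψ_T(N−1,N−2) g₁ dμ_T`.

§A: line derivatives along `p_l` and two mixed partials (`∂_{p_l}∂_{q_b}ψ`, `∂_{p_l'}∂_{p_l}Φ₁`).
§B: the moment identity at a generic bath end `(b, j)` from the closed form `Φ = Lψ_{bj}` with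
tempered data — the regularity of `Ψ = L²ψ − γLψ + κψ` and of the Gibbs corrector
`G♯ = A_bΦ + A^q_bψ` (smooth; `G♯, ∂_{p_0}G♯, ∂_{p_{N−1}}G♯` tempered) is discharged here and fed,
with the bracket (C3) of 22b, the parity zero (G1a) of 23b and the normalisation (G1b) of 23d, into
the abstract identity `momentCoefficient_eq_of_bracket` (24d).  §C: the hot end (`Φ = Φ₁`, 21b/23d)
and the cold end (`Φ = Φ₁ ∘ R`, site reflection), and `firstBondBracket_holds : FirstBondBracket`.

Consequence in the tree: `firstBondTransfer_of_bracket` (21f) now yields `FirstBondTransfer`, so the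
door's hypothesis `FirstBondBracket` is discharged; the leaves left under the door are
`(∀ ρ < 1, PeeledLocalityLaw ρ 1)`, `ResponseRegularity`, `FirstOrderEntropyProduction`,
`EscapeInfZero`, `SubOhmicBootstrap`.

No new definitions.  Written for the decomposition cell `decomp-a2c` (lens 1, g66).
-/

noncomputable section

open MeasureTheory Filter Topology Set
open scoped NNReal ENNReal ContDiff

namespace Summit.AtomisticToContinuum.FouriersLaw.Theorems.SubdiffusiveBondHeat.EscapeGrading

open Literature.MathematicalPhysics.KineticTheory.HeatConduction
open Literature.Probability.Process Literature.MathematicalPhysics.KineticTheory OscillatorChain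
open Summit.AtomisticToContinuum.FouriersLaw.Theorems.SubdiffusiveBondHeat.JunctionDefectGrading

variable {N : ℕ} {ω₂ lam β γ : ℝ}

/-! ## A. Line derivatives and two mixed partials -/

/-- For differentiable `F`, `t ↦ F(q, p[l ↦ t])` has derivative `∂_{p_l}F(x)` at `t = p_l`. [calculus] -/
theorem hasDerivAt_lineP {F : PhaseSpace N → ℝ} (hF : Differentiable ℝ F) (l : Fin N)
    (x : PhaseSpace N) :
    HasDerivAt (fun t => F (x.1, Function.update x.2 l t)) (partialP l F x) (x.2 l) := by
  have hline : Differentiable ℝ fun t : ℝ => ((x.1, Function.update x.2 l t) : PhaseSpace N) :=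
    (differentiable_const _).prodMk fun t => (hasDerivAt_update x.2 l t).differentiableAt
  exact ((hF.comp hline) (x.2 l)).hasDerivAt

/-- `∂_{p_l}∂_{q_b}ψ_{ij} = δ_{jl} φ′(q_j − q_i)(δ_{jb} − δ_{ib})`. [calculus] -/
theorem partialP_partialQ_transferTest (hβ : 0 ≤ β) (i j b l : Fin N) (x : PhaseSpace N) :
    partialP l (partialQ b (transferTest β N i j)) x =
      (if j = l then 1 else 0) *
        (transferDPhi β (x.1 j - x.1 i) * ((if j = b then 1 else 0) - (if i = b then 1 else 0))) := by
  rw [show partialQ b (transferTest β N i j) = fun y : PhaseSpace N =>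
      y.2 j * (transferDPhi β (y.1 j - y.1 i) * ((if j = b then 1 else 0) - (if i = b then 1 else 0)))
    from funext (partialQ_transferTest hβ i j b)]
  unfold partialP
  have key : HasDerivAt (fun t => (fun y : PhaseSpace N =>
      y.2 j * (transferDPhi β (y.1 j - y.1 i) * ((if j = b then 1 else 0) - (if i = b then 1 else 0))))
      (x.1, Function.update x.2 l t)) _ (x.2 l) :=
    (hasDerivAt_update_eval x.2 l j).mul_const
      (transferDPhi β (x.1 j - x.1 i) * ((if j = b then 1 else 0) - (if i = b then 1 else 0)))
  exact key.deriv

/-- `∂_{p_l'}∂_{p_l}Φ₁ = ((δ_{1l} − δ_{0l})δ_{1l'} + (δ_{1l'} − δ_{0l'})δ_{1l}) φ′(r)` (bounded × `φ′`). [calculus] -/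
theorem partialP_partialP_genTransferHot_mixed (hN : 3 ≤ N) (l l' : Fin N) (x : PhaseSpace N) :
    partialP l' (partialP l (genTransferHot ω₂ lam β N hN)) x =
      (((if site1 hN = l then 1 else 0) - (if site0 hN = l then 1 else 0)) * (if site1 hN = l' then 1 else 0)
        + ((if site1 hN = l' then 1 else 0) - (if site0 hN = l' then 1 else 0))
          * (if site1 hN = l then 1 else 0))
        * transferDPhi β (x.1 (site1 hN) - x.1 (site0 hN)) := by
  rw [partialP_genTransferHot_fun]
  unfold partialP
  have key : HasDerivAt (fun t => (fun y : PhaseSpace N =>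
      (((if site1 hN = l then 1 else 0) - (if site0 hN = l then 1 else 0)) * y.2 (site1 hN)
        + (y.2 (site1 hN) - y.2 (site0 hN)) * (if site1 hN = l then 1 else 0))
        * transferDPhi β (y.1 (site1 hN) - y.1 (site0 hN))) (x.1, Function.update x.2 l' t)) _ (x.2 l') :=
    (((hasDerivAt_update_eval x.2 l' (site1 hN)).const_mul
        ((if site1 hN = l then (1 : ℝ) else 0) - (if site0 hN = l then (1 : ℝ) else 0))).fun_add
      (((hasDerivAt_update_eval x.2 l' (site1 hN)).fun_sub
        (hasDerivAt_update_eval x.2 l' (site0 hN))).mul_const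
        (if site1 hN = l then (1 : ℝ) else 0))).mul_const (transferDPhi β (x.1 (site1 hN) - x.1 (site0 hN)))
  exact key.deriv

/-! ## B. The moment identity at a generic bath end -/

/-- **[BI] at a generic bath end `(b, j)`.**  Let `h` be a response density, `g` a tap score at the
bath site `b` with drive `a`, `τ` the moment coefficient of site `j`; let `Φ = Lψ_{bj}` be given in
closed form with `Φ, ∂_pΦ, ∂_p∂_pΦ, LΦ` tempered, and assume the bracket (C3)
`p_j²/T − 1 = A_bΨ − L(A_bΦ + A^q_bψ)`, the parity zero (G1a) `∫ (A_bΦ + A^q_bψ)(p_0² − p_{N−1}²) dμ_T = 0`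
and the normalisation (G1b) `∫ p_b Ψ dμ_T = T`.  Then `τ = T ∫ Ψ g dμ_T + a T²`.
The proof supplies the regularity of `Ψ` and `G♯ = A_bΦ + A^q_bψ` (with
`∂_{p_l}G♯ = δ_{bl}Φ/T + p_b ∂_{p_l}Φ/T − ∂_{p_l}∂_{p_b}Φ + ∂_{q_b}H ∂_{p_l}ψ/T − ∂_{p_l}∂_{q_b}ψ`)
and calls `momentCoefficient_eq_of_bracket` (24d). [assembly] -/
theorem momentCoefficient_eq_of_transfer (hω : 0 < ω₂) (hl : 0 < lam) (hβ : 0 < β) (hγ : 0 < γ)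
    {T : ℝ} (hT : 0 < T) (hN : 1 ≤ N) {b j : Fin N} {a τ : ℝ} {h g Φ : PhaseSpace N → ℝ}
    (hh : IsResponseDensityAt ω₂ lam β γ T N h) (hg : IsTapScoreAt ω₂ lam β γ T N b a h g)
    (hτ : IsMomentCoefficientAt ω₂ lam β γ T N j τ)
    (hΦ : (pinnedChain ω₂ lam β γ).generator N T T (transferTest β N b j) = Φ)
    (hΦt : IsTempered ω₂ lam β γ N Φ) (hΦp : ∀ l, IsTempered ω₂ lam β γ N (partialP l Φ))
    (hΦpp : ∀ l l', IsTempered ω₂ lam β γ N (partialP l' (partialP l Φ)))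
    (hLΦ : IsTempered ω₂ lam β γ N ((pinnedChain ω₂ lam β γ).generator N T T Φ))
    (hC3 : ∀ x : PhaseSpace N, x.2 j ^ 2 / T - 1 =
      adjointP T b (transferObservable ω₂ lam β γ T N b j) x
        - (pinnedChain ω₂ lam β γ).generator N T T (fun y =>
            adjointP T b Φ y + adjointQ (pinnedChain ω₂ lam β γ) T b (transferTest β N b j) y) x)
    (hG1a : ∫ x, (adjointP T b Φ x + adjointQ (pinnedChain ω₂ lam β γ) T b (transferTest β N b j) x)
        * (x.2 ⟨0, by omega⟩ ^ 2 - x.2 ⟨N - 1, by omega⟩ ^ 2)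
        ∂(pinnedChain ω₂ lam β γ).gibbsMeasure N T = 0)
    (hG1b : ∫ x, x.2 b * transferObservable ω₂ lam β γ T N b j x
        ∂(pinnedChain ω₂ lam β γ).gibbsMeasure N T = T) :
    τ = T * ∫ x, transferObservable ω₂ lam β γ T N b j x * g x
      ∂(pinnedChain ω₂ lam β γ).gibbsMeasure N T + a * T ^ 2 := by
  have htop1 : ((⊤ : ℕ∞) : WithTop ℕ∞) + 1 ≤ ((⊤ : ℕ∞) : WithTop ℕ∞) := by exact_mod_cast le_top
  have htop2 : ((⊤ : ℕ∞) : WithTop ℕ∞) + 2 ≤ ((⊤ : ℕ∞) : WithTop ℕ∞) :=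
    calc ((⊤ : ℕ∞) : WithTop ℕ∞) + 2 = (⊤ : ℕ∞) + 1 + 1 := by rw [add_assoc, one_add_one_eq_two]
      _ ≤ (⊤ : ℕ∞) + 1 := add_le_add_right htop1 1
      _ ≤ (⊤ : ℕ∞) := htop1
  have h1top : (1 : WithTop ℕ∞) ≤ ((⊤ : ℕ∞) : WithTop ℕ∞) := by exact_mod_cast le_top
  have h0top : ((⊤ : ℕ∞) : WithTop ℕ∞) ≠ 0 := (lt_of_lt_of_le zero_lt_one h1top).ne'
  have H0 := hω.le
  have hl' := hl.le
  have hβ' := hβ.le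
  have hU := pinnedChain_contDiff_U ω₂ lam β γ (n := ∞)
  have hV := pinnedChain_contDiff_V ω₂ lam β γ (n := ∞)
  have hH : ContDiff ℝ ((⊤ : ℕ∞) : WithTop ℕ∞) ((pinnedChain ω₂ lam β γ).hamiltonian N) :=
    (pinnedChain ω₂ lam β γ).contDiff_hamiltonian (pinnedChain_contDiff_U ω₂ lam β γ)
      (pinnedChain_contDiff_V ω₂ lam β γ) N
  have s := fun k : Fin N => IsTempered.snd (γ := γ) H0 hl' hβ' k
  -- `ψ`, `Φ`
  have hψ : ContDiff ℝ ((⊤ : ℕ∞) : WithTop ℕ∞) (transferTest β N b j) := contDiff_transferTest hβ' b j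
  have hψt := fun l => isTempered_transferTest (γ := γ) hω hl' hβ' b j l
  have dph := (isTempered_transferPhi (ω₂ := ω₂) (lam := lam) (γ := γ) hβ' b j).2.1
  have hΦs : ContDiff ℝ ((⊤ : ℕ∞) : WithTop ℕ∞) Φ :=
    hΦ ▸ contDiff_generator_of_contDiff _ hU hV T T hψ htop2
  have hLΦs : ContDiff ℝ ((⊤ : ℕ∞) : WithTop ℕ∞) ((pinnedChain ω₂ lam β γ).generator N T T Φ) :=
    contDiff_generator_of_contDiff _ hU hV T T hΦs htop2
  -- `Ψ = LΦ − γΦ + κψ` is smooth and tempered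
  have eΨ : ∀ x, transferObservable ω₂ lam β γ T N b j x =
      (pinnedChain ω₂ lam β γ).generator N T T Φ x - γ * Φ x
        + (ω₂ + 3 * lam * x.1 b ^ 2 + (1 + 3 * β * (x.1 j - x.1 b) ^ 2)) * transferTest β N b j x :=
    fun x => by unfold transferObservable; rw [hΦ]
  have hκ : ContDiff ℝ ((⊤ : ℕ∞) : WithTop ℕ∞) fun x : PhaseSpace N =>
      ω₂ + 3 * lam * x.1 b ^ 2 + (1 + 3 * β * (x.1 j - x.1 b) ^ 2) := by fun_prop
  have hΨs : ContDiff ℝ ((⊤ : ℕ∞) : WithTop ℕ∞) (transferObservable ω₂ lam β γ T N b j) := by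
    rw [show transferObservable ω₂ lam β γ T N b j = fun x =>
        (pinnedChain ω₂ lam β γ).generator N T T Φ x - γ * Φ x
          + (ω₂ + 3 * lam * x.1 b ^ 2 + (1 + 3 * β * (x.1 j - x.1 b) ^ 2)) * transferTest β N b j x
      from funext eΨ]
    exact (hLΦs.sub (contDiff_const.mul hΦs)).add (hκ.mul hψ)
  have hκψt : IsTempered ω₂ lam β γ N fun x : PhaseSpace N =>
      (ω₂ + 3 * lam * x.1 b ^ 2 + (1 + 3 * β * (x.1 j - x.1 b) ^ 2)) * transferTest β N b j x :=
    (((IsTempered.const ω₂).add H0 hl' hβ'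
      (((IsTempered.fst hω hl' hβ' b).pow 2).const_mul (3 * lam))).add H0 hl' hβ'
      ((IsTempered.const 1).add H0 hl' hβ' ((((IsTempered.fst hω hl' hβ' j).sub H0 hl' hβ'
        (IsTempered.fst hω hl' hβ' b)).pow 2).const_mul (3 * β)))).mul (hψt b).1
  have hΨt : IsTempered ω₂ lam β γ N (transferObservable ω₂ lam β γ T N b j) :=
    ((hLΦ.sub H0 hl' hβ' (hΦt.const_mul γ)).add H0 hl' hβ' hκψt).of_eq eΨ
  -- `G♯ = A_bΦ + A^q_bψ` is smooth and tempered
  have hGs : ContDiff ℝ ((⊤ : ℕ∞) : WithTop ℕ∞) fun y =>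
      adjointP T b Φ y + adjointQ (pinnedChain ω₂ lam β γ) T b (transferTest β N b j) y :=
    (contDiff_adjointP hΦs htop1 T b).add (contDiff_adjointQ ω₂ lam β γ hψ htop1 T b)
  have hGt : IsTempered ω₂ lam β γ N fun y =>
      adjointP T b Φ y + adjointQ (pinnedChain ω₂ lam β γ) T b (transferTest β N b j) y :=
    (((((s b).mul hΦt).const_mul T⁻¹).sub H0 hl' hβ' (hΦp b)).add H0 hl' hβ'
      ((((IsTempered.partialQ_hamiltonian hω hl' hβ' b).mul (hψt b).1).const_mul T⁻¹).sub H0 hl' hβ'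
        (hψt b).2.1)).of_eq fun x => by simp only [adjointP, adjointQ]; ring
  -- `∂_{p_l}G♯` and its temperedness
  have hψd : Differentiable ℝ (transferTest β N b j) := hψ.differentiable h0top
  have hΦd : Differentiable ℝ Φ := hΦs.differentiable h0top
  have hΦbd : Differentiable ℝ (partialP b Φ) := (contDiff_partialP hΦs htop1 b).differentiable h0top
  have hHbd : Differentiable ℝ (partialQ b ((pinnedChain ω₂ lam β γ).hamiltonian N)) :=
    (contDiff_partialQ hH htop1 b).differentiable h0top
  have hψbd : Differentiable ℝ (partialQ b (transferTest β N b j)) :=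
    (contDiff_partialQ hψ htop1 b).differentiable h0top
  have eH : ∀ x : PhaseSpace N, partialQ b ((pinnedChain ω₂ lam β γ).hamiltonian N) x =
      (pinnedChain ω₂ lam β γ).dPotential N b x.1 := fun x =>
    (pinnedChain ω₂ lam β γ).partialQ_hamiltonian_eq_dPotential
      ((pinnedChain_contDiff_U ω₂ lam β γ (n := 1)).differentiable (by norm_num))
      ((pinnedChain_contDiff_V ω₂ lam β γ (n := 1)).differentiable (by norm_num)) N x b
  have hq0 : ∀ (l : Fin N) (x : PhaseSpace N),
      partialP l (partialQ b ((pinnedChain ω₂ lam β γ).hamiltonian N)) x = 0 := fun l x => by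
    rw [show partialQ b ((pinnedChain ω₂ lam β γ).hamiltonian N) = fun y : PhaseSpace N =>
        (pinnedChain ω₂ lam β γ).dPotential N b y.1 from funext eH]
    simp [partialP]
  have eG : ∀ (l : Fin N) (x : PhaseSpace N),
      partialP l (fun y => adjointP T b Φ y
        + adjointQ (pinnedChain ω₂ lam β γ) T b (transferTest β N b j) y) x =
      (if b = l then 1 else 0) / T * Φ x + x.2 b / T * partialP l Φ x - partialP l (partialP b Φ) x
        + (partialQ b ((pinnedChain ω₂ lam β γ).hamiltonian N) x / T * partialP l (transferTest β N b j) x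
          - partialP l (partialQ b (transferTest β N b j)) x) := fun l x => by
    have key : HasDerivAt (fun t => Function.update x.2 l t b / T * Φ (x.1, Function.update x.2 l t)
        - partialP b Φ (x.1, Function.update x.2 l t)
        + (partialQ b ((pinnedChain ω₂ lam β γ).hamiltonian N) (x.1, Function.update x.2 l t) / T *
            transferTest β N b j (x.1, Function.update x.2 l t)
          - partialQ b (transferTest β N b j) (x.1, Function.update x.2 l t))) _ (x.2 l) :=
      ((((hasDerivAt_update_eval x.2 l b).div_const T).fun_mul (hasDerivAt_lineP hΦd l x)).fun_sub
        (hasDerivAt_lineP hΦbd l x)).fun_add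
        ((((hasDerivAt_lineP hHbd l x).div_const T).fun_mul (hasDerivAt_lineP hψd l x)).fun_sub
          (hasDerivAt_lineP hψbd l x))
    have e : partialP l (fun y => adjointP T b Φ y
        + adjointQ (pinnedChain ω₂ lam β γ) T b (transferTest β N b j) y) x = _ := key.deriv
    rw [e, hq0 l x]
    simp only [Function.update_eq_self, Prod.mk.eta]
    ring
  have hGp : ∀ l, IsTempered ω₂ lam β γ N (partialP l fun y => adjointP T b Φ y
      + adjointQ (pinnedChain ω₂ lam β γ) T b (transferTest β N b j) y) := fun l =>
    ((((hΦt.const_mul ((if b = l then 1 else 0) / T)).add H0 hl' hβ'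
      (((s b).mul (hΦp l)).const_mul T⁻¹)).sub H0 hl' hβ' (hΦpp b l)).add H0 hl' hβ'
      ((((IsTempered.partialQ_hamiltonian hω hl' hβ' b).mul (hψt l).2.2.1).const_mul T⁻¹).sub H0 hl' hβ'
        ((dph.mul (IsTempered.const ((if j = b then (1 : ℝ) else 0) - (if b = b then (1 : ℝ) else 0)))).const_mul
          (if j = l then (1 : ℝ) else 0)))).of_eq fun x => by
      rw [eG l x, partialP_partialQ_transferTest hβ' b j b l x]
      ring
  -- (G1a) in the orientation of 24d, then the abstract identity
  have hG1a' : ∫ x, (x.2 ⟨0, by omega⟩ ^ 2 - x.2 ⟨N - 1, by omega⟩ ^ 2) * (adjointP T b Φ x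
      + adjointQ (pinnedChain ω₂ lam β γ) T b (transferTest β N b j) x)
      ∂(pinnedChain ω₂ lam β γ).gibbsMeasure N T = 0 := by
    rw [← hG1a]
    exact integral_congr_ae (ae_of_all _ fun x => mul_comm _ _)
  exact momentCoefficient_eq_of_bracket hω hl hβ hγ hT hN hh hg hτ hΨs hΨt hGs hGt (hGp _) (hGp _)
    hC3 hG1a' hG1b

/-! ## C. The two bath ends and `FirstBondBracket` -/

/-- **[BI], hot end:** `τ_1 − 1/2 = T ∫ Ψ_T(0,1) g₀ dμ_T` (`Φ = Φ₁` of 21b). -/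
theorem firstBondBracketAt_hot (hω : 0 < ω₂) (hl : 0 < lam) (hβ : 0 < β) (hγ : 0 < γ) {T : ℝ}
    (hT : 0 < T) (hN : 3 ≤ N) {h g₀ : PhaseSpace N → ℝ} {τ : ℝ}
    (hh : IsResponseDensityAt ω₂ lam β γ T N h)
    (hg : IsTapScoreAt ω₂ lam β γ T N ⟨0, by omega⟩ (1 / (2 * T ^ 2)) h g₀)
    (hτ : IsMomentCoefficientAt ω₂ lam β γ T N ⟨1, by omega⟩ τ) :
    τ - 1 / 2 = T * ∫ x, transferObservable ω₂ lam β γ T N ⟨0, by omega⟩ ⟨1, by omega⟩ x * g₀ x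
      ∂(pinnedChain ω₂ lam β γ).gibbsMeasure N T := by
  have hT0 : T ≠ 0 := hT.ne'
  have hΦ := generator_transferTest_hot_eq hN hβ.le T T (ω₂ := ω₂) (lam := lam) (γ := γ)
  obtain ⟨hΦ₁, hLΦ₁⟩ := isTempered_genTransferHot hω hl.le hβ.le hγ.le hN
  have dph := (isTempered_transferPhi (ω₂ := ω₂) (lam := lam) (γ := γ) hβ.le (site0 hN) (site1 hN)).2.1
  have key := momentCoefficient_eq_of_transfer hω hl hβ hγ hT (by omega) hh hg hτ hΦ hΦ₁
    (fun l => (isTempered_partial_genTransferHot hω hl.le hβ.le hN l).2.1)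
    (fun l l' => (dph.const_mul _).of_eq (partialP_partialP_genTransferHot_mixed hN l l'))
    (hLΦ₁.of_eq (generator_genTransferHot hN hβ.le T T))
    (fun x => by rw [← hΦ]; exact transferBracket_pointwise_hot ω₂ lam β γ hT0 hβ.le hN x)
    (by rw [← hΦ]
        exact integral_transferSource_mul_gibbsMeasure_eq_zero (pinnedChain ω₂ lam β γ) T T T β _
          (by show (1 : ℕ) ≠ 0; omega) (by show (1 : ℕ) ≠ N - 1; omega)
          (sq_sub_sq_flip ⟨0, by omega⟩ ⟨N - 1, by omega⟩))
    (integral_snd_mul_transferObservable_gibbsMeasure hω hl.le hβ.le hγ.le hT hN).1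
  rw [key]
  field_simp
  ring

/-- **[BI], cold end:** `τ_{N−2} + 1/2 = T ∫ Ψ_T(N−1,N−2) g₁ dμ_T` (`Φ = Φ₁ ∘ R`, site reflection). -/
theorem firstBondBracketAt_cold (hω : 0 < ω₂) (hl : 0 < lam) (hβ : 0 < β) (hγ : 0 < γ) {T : ℝ}
    (hT : 0 < T) (hN : 3 ≤ N) {h g₁ : PhaseSpace N → ℝ} {τ' : ℝ}
    (hh : IsResponseDensityAt ω₂ lam β γ T N h)
    (hg : IsTapScoreAt ω₂ lam β γ T N ⟨N - 1, by omega⟩ (-(1 / (2 * T ^ 2))) h g₁)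
    (hτ : IsMomentCoefficientAt ω₂ lam β γ T N ⟨N - 1 - 1, by omega⟩ τ') :
    τ' + 1 / 2 = T * ∫ x, transferObservable ω₂ lam β γ T N ⟨N - 1, by omega⟩ ⟨N - 1 - 1, by omega⟩ x
      * g₁ x ∂(pinnedChain ω₂ lam β γ).gibbsMeasure N T := by
  have hT0 : T ≠ 0 := hT.ne'
  have hV := pinnedChain_V_neg ω₂ lam β γ
  have hΦ : (pinnedChain ω₂ lam β γ).generator N T T
      (transferTest β N ⟨N - 1, by omega⟩ ⟨N - 1 - 1, by omega⟩) =
        genTransferHot ω₂ lam β N hN ∘ siteReflection N := by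
    rw [last_eq_rev_site0 hN, lastButOne_eq_rev_site1 hN, generator_transferTest_rev,
      generator_transferTest_hot_eq hN hβ.le]
  obtain ⟨hΦ₁, hLΦ₁⟩ := isTempered_genTransferHot hω hl.le hβ.le hγ.le hN
  have dph := (isTempered_transferPhi (ω₂ := ω₂) (lam := lam) (γ := γ) hβ.le (site0 hN) (site1 hN)).2.1
  have hmix : ∀ l l', IsTempered ω₂ lam β γ N
      (partialP l' (partialP l (genTransferHot ω₂ lam β N hN ∘ siteReflection N))) := fun l l' =>
    ((dph.const_mul _).comp_siteReflection).of_eq fun x => by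
      rw [show partialP l (genTransferHot ω₂ lam β N hN ∘ siteReflection N) =
          partialP (Fin.rev l) (genTransferHot ω₂ lam β N hN) ∘ siteReflection N
        from funext fun y => partialP_comp_siteReflection l _ y,
        partialP_comp_siteReflection, partialP_partialP_genTransferHot_mixed hN, Function.comp_apply]
  have key := momentCoefficient_eq_of_transfer hω hl hβ hγ hT (by omega) hh hg hτ hΦ
    hΦ₁.comp_siteReflection
    (fun l => ((isTempered_partial_genTransferHot hω hl.le hβ.le hN (Fin.rev l)).2.1.comp_siteReflection).of_eq
      (partialP_comp_siteReflection l _))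
    hmix
    (hLΦ₁.comp_siteReflection.of_eq fun x => by
      rw [(pinnedChain ω₂ lam β γ).generator_comp_siteReflection hV N T T, Function.comp_apply,
        generator_genTransferHot hN hβ.le])
    (fun x => by rw [← hΦ]; exact transferBracket_pointwise_cold ω₂ lam β γ hT0 hβ.le hN x)
    (by rw [← hΦ]
        exact integral_transferSource_mul_gibbsMeasure_eq_zero (pinnedChain ω₂ lam β γ) T T T β _
          (by show (N - 1 - 1 : ℕ) ≠ 0; omega) (by show (N - 1 - 1 : ℕ) ≠ N - 1; omega)
          (sq_sub_sq_flip ⟨0, by omega⟩ ⟨N - 1, by omega⟩))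
    (integral_snd_mul_transferObservable_gibbsMeasure hω hl.le hβ.le hγ.le hT hN).2
  rw [key]
  field_simp
  ring

/-- **[BI] — the first-bond bracket identity at both bath ends** (leaf of the `BoundedResponse`
decomposition; with 21f `firstBondTransfer_of_bracket` it closes `FirstBondTransfer`). -/
theorem firstBondBracket_holds : FirstBondBracket := by
  intro ω₂ lam β γ hω hl hβ hγ T hT N hN h g₀ g₁ τ τ' hh hg₀ hg₁ hτ hτ'
  exact ⟨firstBondBracketAt_hot hω hl hβ hγ hT hN hh hg₀ hτ,
    firstBondBracketAt_cold hω hl hβ hγ hT hN hh hg₁ hτ'⟩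

end Summit.AtomisticToContinuum.FouriersLaw.Theorems.SubdiffusiveBondHeat.EscapeGrading

end
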